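import Summits.HubbardSuperconductivity.HubbardSuperconductivity.Theses.ThermalWedge

/-!
# drefute (line `exposed-density-duality`, crux stmt-HubbardSuperconductivity-1698): the THIN transfer

Mutation finding for the lead: the closer `stub_closer` consumes the transfer `stub_exposedDensityT0`
only through the kink lemma, i.e. through the two one-sided SECANT inequalities of the finite-`L`
grand-canonical ground energy at `μ₀ ± τ`.  `SecantPinchT0` below records exactly that output; it is
implied by `stub_exposedDensityT0` (theorem `secantPinchT0_of_exposedDensityT0`, sorry-free) and does
not mention the thermodynamic limit `e` at all.  Re-basing the closer on `SecantPinchT0` removes the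
"limit exists on a neighbourhood" half of the transfer from the line's open input.

`kink_lemma` is copied verbatim from `Cruxes/TwSeededEnsembleEquivalence/Sketch-ideator1.lean`
(crux-ideate r1 ideator 1 gen 2, proved there); it is repeated here only because that work file is not an
importable module.
-/

set_option linter.dupNamespace false

namespace Summit.HubbardSuperconductivity.HubbardSuperconductivity.Theorems.TwSeededEnsembleEquivalence.ExposedDensity.Drefute

open Matrix Filter Topology Literature.MathematicalPhysics.QuantumLattice

noncomputable section

/-- **Kink lemma** (ideator 1, `Sketch-ideator1.lean`, verbatim): pointwise convergence near `μ₀` plus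
differentiability of the limit at `μ₀` pins the one-sided secant slopes of the approximants. -/
theorem kink_lemma (f : ℕ → ℝ → ℝ) (e : ℝ → ℝ) (μ₀ d r : ℝ) (hr : 0 < r)
    (hlim : ∀ μ ∈ Set.Icc (μ₀ - r) (μ₀ + r), Tendsto (fun L => f L μ) atTop (𝓝 (e μ)))
    (hd : HasDerivAt e d μ₀) :
    ∀ η : ℝ, 0 < η → ∃ τ : ℝ, 0 < τ ∧ τ ≤ r ∧ ∃ L₀ : ℕ, ∀ L, L₀ ≤ L →
      |(f L (μ₀ + τ) - f L μ₀) / τ - d| ≤ η ∧ |(f L μ₀ - f L (μ₀ - τ)) / τ - d| ≤ η := by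
  intro η hη
  have hslope := hd.tendsto_slope_zero
  rw [Metric.tendsto_nhdsWithin_nhds] at hslope
  obtain ⟨δ, hδ, hδ'⟩ := hslope (η / 2) (by linarith)
  set τ : ℝ := min (δ / 2) r with hτ
  have hτpos : 0 < τ := lt_min (by linarith) hr
  have hτr : τ ≤ r := min_le_right _ _
  have hτδ : τ < δ := lt_of_le_of_lt (min_le_left _ _) (by linarith)
  refine ⟨τ, hτpos, hτr, ?_⟩
  have hmem0 : μ₀ ∈ Set.Icc (μ₀ - r) (μ₀ + r) := ⟨by linarith, by linarith⟩
  have hmemp : μ₀ + τ ∈ Set.Icc (μ₀ - r) (μ₀ + r) := ⟨by linarith, by linarith⟩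
  have hmemm : μ₀ - τ ∈ Set.Icc (μ₀ - r) (μ₀ + r) := ⟨by linarith, by linarith⟩
  have hε : 0 < η * τ / 4 := by positivity
  obtain ⟨N0, hN0⟩ := Metric.tendsto_atTop.1 (hlim μ₀ hmem0) (η * τ / 4) hε
  obtain ⟨Np, hNp⟩ := Metric.tendsto_atTop.1 (hlim (μ₀ + τ) hmemp) (η * τ / 4) hε
  obtain ⟨Nm, hNm⟩ := Metric.tendsto_atTop.1 (hlim (μ₀ - τ) hmemm) (η * τ / 4) hε
  refine ⟨max N0 (max Np Nm), fun L hL => ?_⟩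
  have hL0 : N0 ≤ L := le_trans (le_max_left _ _) hL
  have hLp : Np ≤ L := le_trans (le_trans (le_max_left _ _) (le_max_right _ _)) hL
  have hLm : Nm ≤ L := le_trans (le_trans (le_max_right _ _) (le_max_right _ _)) hL
  have e0 := hN0 L hL0
  have ep := hNp L hLp
  have em := hNm L hLm
  rw [Real.dist_eq] at e0 ep em
  have sp := hδ' (x := τ) (by simp [hτpos.ne']) (by rw [dist_zero_right, Real.norm_eq_abs, abs_of_pos hτpos]; exact hτδ)
  have sm := hδ' (x := -τ) (by simp [hτpos.ne']) (by rw [dist_zero_right, Real.norm_eq_abs, abs_neg, abs_of_pos hτpos]; exact hτδ)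
  rw [Real.dist_eq] at sp sm
  simp only [smul_eq_mul] at sp sm
  have hτne : τ ≠ 0 := hτpos.ne'
  constructor
  · have key : (f L (μ₀ + τ) - f L μ₀) / τ - d =
        (τ⁻¹ * (e (μ₀ + τ) - e μ₀) - d) + ((f L (μ₀ + τ) - e (μ₀ + τ)) - (f L μ₀ - e μ₀)) / τ := by
      field_simp
      ring
    rw [key]
    have h1 : |τ⁻¹ * (e (μ₀ + τ) - e μ₀) - d| ≤ η / 2 := sp.le
    have h2 : |((f L (μ₀ + τ) - e (μ₀ + τ)) - (f L μ₀ - e μ₀)) / τ| ≤ η / 2 := by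
      rw [abs_div, abs_of_pos hτpos, div_le_iff₀ hτpos]
      calc |(f L (μ₀ + τ) - e (μ₀ + τ)) - (f L μ₀ - e μ₀)|
          ≤ |f L (μ₀ + τ) - e (μ₀ + τ)| + |f L μ₀ - e μ₀| := abs_sub _ _
        _ ≤ η * τ / 4 + η * τ / 4 := add_le_add ep.le e0.le
        _ = η / 2 * τ := by ring
    calc |τ⁻¹ * (e (μ₀ + τ) - e μ₀) - d + ((f L (μ₀ + τ) - e (μ₀ + τ)) - (f L μ₀ - e μ₀)) / τ|
        ≤ |τ⁻¹ * (e (μ₀ + τ) - e μ₀) - d| + |((f L (μ₀ + τ) - e (μ₀ + τ)) - (f L μ₀ - e μ₀)) / τ| :=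
          abs_add_le _ _
      _ ≤ η / 2 + η / 2 := add_le_add h1 h2
      _ = η := by ring
  · have key : (f L μ₀ - f L (μ₀ - τ)) / τ - d =
        ((-τ)⁻¹ * (e (μ₀ + -τ) - e μ₀) - d) + ((f L μ₀ - e μ₀) - (f L (μ₀ - τ) - e (μ₀ - τ))) / τ := by
      rw [← sub_eq_add_neg]
      field_simp
      ring
    rw [key]
    have h1 : |(-τ)⁻¹ * (e (μ₀ + -τ) - e μ₀) - d| ≤ η / 2 := sm.le
    have h2 : |((f L μ₀ - e μ₀) - (f L (μ₀ - τ) - e (μ₀ - τ))) / τ| ≤ η / 2 := by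
      rw [abs_div, abs_of_pos hτpos, div_le_iff₀ hτpos]
      calc |(f L μ₀ - e μ₀) - (f L (μ₀ - τ) - e (μ₀ - τ))|
          ≤ |f L μ₀ - e μ₀| + |f L (μ₀ - τ) - e (μ₀ - τ)| := abs_sub _ _
        _ ≤ η * τ / 4 + η * τ / 4 := add_le_add e0.le em.le
        _ = η / 2 * τ := by ring
    calc |(-τ)⁻¹ * (e (μ₀ + -τ) - e μ₀) - d + ((f L μ₀ - e μ₀) - (f L (μ₀ - τ) - e (μ₀ - τ))) / τ|
        ≤ |(-τ)⁻¹ * (e (μ₀ + -τ) - e μ₀) - d| + |((f L μ₀ - e μ₀) - (f L (μ₀ - τ) - e (μ₀ - τ))) / τ| :=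
          abs_add_le _ _
      _ ≤ η / 2 + η / 2 := add_le_add h1 h2
      _ = η := by ring

/-- The seeded grand-canonical ground energy on the torus of side `L` (literal tree term, as in the
lead's skeleton). -/
abbrev E0gc (L : ℕ) [NeZero L] (U μ g : ℝ) : ℝ :=
  (hubbardTorusWith 2 L 1 U μ - ((g / (L : ℝ) ^ 2 : ℝ) : ℂ) •
    ((pairField dWaveFormFactor L)ᴴ * pairField dWaveFormFactor L)).groundEnergy

/-- The lead's transfer `stub_exposedDensityT0`, verbatim as a `Prop`. -/
def ExposedDensityT0Stmt : Prop :=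
  ∀ δ ∈ Set.Icc (1/10 : ℝ) (2/5 : ℝ), ∃ μ₁ μ₂ : ℝ, -4 < μ₁ ∧ μ₁ ≤ μ₂ ∧ μ₂ < 0 ∧
    ∃ U₀ : ℝ, 0 < U₀ ∧ ∀ U ∈ Set.Ioc (0 : ℝ) U₀, ∀ g ∈ Set.Ioc (0 : ℝ) (1 / 10),
      ∃ μ₀ ∈ Set.Icc μ₁ μ₂, ∃ e : ℝ → ℝ, ∃ r : ℝ, 0 < r ∧
        (∀ μ ∈ Set.Icc (μ₀ - r) (μ₀ + r),
          Tendsto (fun L : ℕ =>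
            (hubbardTorusWith 2 (L + 1) 1 U μ - ((g / ((L + 1 : ℕ) : ℝ) ^ 2 : ℝ) : ℂ) •
              ((pairField dWaveFormFactor (L + 1))ᴴ * pairField dWaveFormFactor (L + 1))).groundEnergy /
              ((L + 1 : ℕ) : ℝ) ^ 2) atTop (𝓝 (e μ))) ∧
        HasDerivAt e (-(1 - δ)) μ₀

/-- **The thin transfer: SECANT PINCH at `T = 0`.** For some `μ₀` of the `δ`-window and every
tolerance `η > 0` there is a scale `τ > 0` at which, eventually in `L`, the right secant of the
grand-canonical ground energy at `μ₀` is `≥ −(1−δ+η) L²` per unit `μ` and the left secant is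
`≤ −(1−δ−η) L²`.  By concavity of `μ ↦ E₀(Hgc_L(μ))` these two numbers bracket `−N°` for every
ground sector `N°` at `μ₀`, which is all the closer uses.  No thermodynamic limit is asserted. -/
def SecantPinchT0 : Prop :=
  ∀ δ ∈ Set.Icc (1/10 : ℝ) (2/5 : ℝ), ∃ μ₁ μ₂ : ℝ, -4 < μ₁ ∧ μ₁ ≤ μ₂ ∧ μ₂ < 0 ∧
    ∃ U₀ : ℝ, 0 < U₀ ∧ ∀ U ∈ Set.Ioc (0 : ℝ) U₀, ∀ g ∈ Set.Ioc (0 : ℝ) (1 / 10),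
      ∃ μ₀ ∈ Set.Icc μ₁ μ₂, ∀ η : ℝ, 0 < η → ∃ τ : ℝ, 0 < τ ∧ ∃ L₀ : ℕ, ∀ (L : ℕ) [NeZero L], L₀ ≤ L →
        -(τ * ((1 - δ) + η)) * (L : ℝ) ^ 2 ≤ E0gc L U (μ₀ + τ) g - E0gc L U μ₀ g ∧
        E0gc L U μ₀ g - E0gc L U (μ₀ - τ) g ≤ -(τ * ((1 - δ) - η)) * (L : ℝ) ^ 2

/-- `stub_exposedDensityT0 → SecantPinchT0` (kink lemma + un-normalising by `L²`). -/
theorem secantPinchT0_of_exposedDensityT0 (h : ExposedDensityT0Stmt) : SecantPinchT0 := by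
  intro δ hδ
  obtain ⟨μ₁, μ₂, hμ₁, hμ₁₂, hμ₂, U₀, hU₀, hU⟩ := h δ hδ
  refine ⟨μ₁, μ₂, hμ₁, hμ₁₂, hμ₂, U₀, hU₀, fun U hUm g hg => ?_⟩
  obtain ⟨μ₀, hμ₀, e, r, hr, hlim, hd⟩ := hU U hUm g hg
  refine ⟨μ₀, hμ₀, fun η hη => ?_⟩
  -- the approximants, indexed so that `f L` lives on the torus of side `L + 1`
  set f : ℕ → ℝ → ℝ := fun L μ => E0gc (L + 1) U μ g / ((L + 1 : ℕ) : ℝ) ^ 2 with hf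
  have hlim' : ∀ μ ∈ Set.Icc (μ₀ - r) (μ₀ + r), Tendsto (fun L => f L μ) atTop (𝓝 (e μ)) :=
    fun μ hμ => hlim μ hμ
  obtain ⟨τ, hτ, -, L₀, hL₀⟩ := kink_lemma f e μ₀ (-(1 - δ)) r hr hlim' hd η hη
  refine ⟨τ, hτ, L₀ + 1, fun L _ hL => ?_⟩
  obtain ⟨L', rfl⟩ : ∃ L', L = L' + 1 := ⟨L - 1, by omega⟩
  have hL' : L₀ ≤ L' := by omega
  obtain ⟨h1, h2⟩ := hL₀ L' hL'
  have hpos : (0 : ℝ) < ((L' + 1 : ℕ) : ℝ) ^ 2 := by positivity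
  -- unfold the secants of `f L'`
  have e1 : f L' (μ₀ + τ) = E0gc (L' + 1) U (μ₀ + τ) g / ((L' + 1 : ℕ) : ℝ) ^ 2 := rfl
  have e2 : f L' μ₀ = E0gc (L' + 1) U μ₀ g / ((L' + 1 : ℕ) : ℝ) ^ 2 := rfl
  have e3 : f L' (μ₀ - τ) = E0gc (L' + 1) U (μ₀ - τ) g / ((L' + 1 : ℕ) : ℝ) ^ 2 := rfl
  rw [e1, e2] at h1
  rw [e2, e3] at h2
  set A := E0gc (L' + 1) U (μ₀ + τ) g with hA
  set B := E0gc (L' + 1) U μ₀ g with hB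
  set C := E0gc (L' + 1) U (μ₀ - τ) g with hC
  set S := ((L' + 1 : ℕ) : ℝ) ^ 2 with hS
  have hSne : S ≠ 0 := hpos.ne'
  -- right secant: (A/S − B/S)/τ ≥ −(1−δ) − η
  have hr1 : -(1 - δ) - η ≤ (A / S - B / S) / τ := by
    have := (abs_le.1 h1).1; linarith
  -- left secant: (B/S − C/S)/τ ≤ −(1−δ) + η
  have hl1 : (B / S - C / S) / τ ≤ -(1 - δ) + η := by
    have := (abs_le.1 h2).2; linarith
  constructor
  · -- multiply through by τ S > 0
    have key : (-(1 - δ) - η) * τ ≤ A / S - B / S := by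
      rwa [le_div_iff₀ hτ] at hr1
    have key2 : ((-(1 - δ) - η) * τ) * S ≤ (A / S - B / S) * S :=
      mul_le_mul_of_nonneg_right key hpos.le
    have hAB : (A / S - B / S) * S = A - B := by field_simp
    rw [hAB] at key2
    have : -(τ * (1 - δ + η)) * S = ((-(1 - δ) - η) * τ) * S := by ring
    rw [this]; exact key2
  · have key : B / S - C / S ≤ (-(1 - δ) + η) * τ := by
      rwa [div_le_iff₀ hτ] at hl1
    have key2 : (B / S - C / S) * S ≤ ((-(1 - δ) + η) * τ) * S :=
      mul_le_mul_of_nonneg_right key hpos.le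
    have hBC : (B / S - C / S) * S = B - C := by field_simp
    rw [hBC] at key2
    have : -(τ * (1 - δ - η)) * S = ((-(1 - δ) + η) * τ) * S := by ring
    rw [this]; exact key2

end

end Summit.HubbardSuperconductivity.HubbardSuperconductivity.Theorems.TwSeededEnsembleEquivalence.ExposedDensity.Drefute
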